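import Summits.NavierStokesRegularity.NavierStokesRegularity.Theses.QuantisedSymmetry
import Summits.NavierStokesRegularity.NavierStokesRegularity.Theses.Blowup
import Summits.NavierStokesRegularity.NavierStokesRegularity.Theorems.QuantisedSymmetryPolyhedralDssProfileExistsDominatesBlowupProfile
import Summits.NavierStokesRegularity.NavierStokesRegularity.Theorems.QuantisedSymmetryLiouvilleKillsProfile
import Summits.NavierStokesRegularity.NavierStokesRegularity.Theorems.QuantisedSymmetryPolyhedralTruncationBridge
import Literature.Analysis.FluidPDE.TypeIAncientMild
import Literature.Analysis.FluidPDE.MildSolution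
import Literature.Analysis.FluidPDE.NSBoundedMildOseen
import Literature.Analysis.FluidPDE.SuitableWeak
import Literature.Analysis.FluidPDE.VectorCalculus
import Literature.Analysis.FluidPDE.AncientAxisymmetricTypeILiouville

/-!
# Strategist s15 / gen 5 (census family `s`) — typed signatures behind `STRATEGY-CENSUS-s15.md`

Crux: `QuantisedSymmetry.PolyhedralDssProfileExists` (stmt-NavierStokesRegularity-1404).

This file carries NO stubs and NO `sorry`: it only (a) certifies from LANDED theorems the two facts the
census verdict rests on — the crux alone decides the summit (`crux → ¬ NavierStokesRegularity`) and the
crux dominates the weaker in-tree intermediate `Blowup.BlowupTypeIDssProfile` (stmt-0155) and the negated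
kill switch — and (b) states, as `Prop`s over existing declarations, the candidate objects examined under
the census headings (weaker intermediate W2, decomposition piece D1(ε), strengthening S⁺_Beltrami), so
that "as a signature" in the census means an elaborated signature.
-/

noncomputable section

set_option linter.dupNamespace false

namespace Summit.NavierStokesRegularity.NavierStokesRegularity.Cruxes.PolyhedralDssProfileExists.StrategistS15

open MeasureTheory Set Function Filter Topology
open Literature.Analysis.FluidPDE
open _root_.Summit.NavierStokesRegularity.NavierStokesRegularity.Theses

/-- `ℝ³`. -/
abbrev E3 := EuclideanSpace ℝ (Fin 3)

/-- The symmetry conjuncts of the crux: a finite group of proper (`det = 1`) linear isometries acting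
irreducibly on `ℝ³` (i.e. conjugate to the rotation group of a Platonic solid, T/O/I). -/
def IsPolyhedralGroup (G : Subgroup (E3 ≃ₗᵢ[ℝ] E3)) : Prop :=
  Finite G ∧ (∀ g ∈ G, LinearMap.det (g.toLinearEquiv : E3 →ₗ[ℝ] E3) = 1) ∧
    (∀ V : Submodule ℝ E3, (∀ g ∈ G, ∀ v ∈ V, g v ∈ V) → V = ⊥ ∨ V = ⊤)

/-! ## §0 The crux is summit-deciding on its own (all co-hypotheses of `closes` are theorems) -/

/-- CERTIFIED: the crux ALONE refutes the summit statement — `closes` with its two other binders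
discharged by landed theorems (`quantisedSymmetry_polyhedralTruncationBridge_proof`, `ClayUniqueness_holds`). -/
example (hX : QuantisedSymmetry.PolyhedralDssProfileExists) : ¬ _root_.NavierStokesRegularity :=
  QuantisedSymmetry.closes hX Theorems.quantisedSymmetry_polyhedralTruncationBridge_proof
    QuantisedSymmetry.ClayUniqueness_holds

/-! ## §1 Weaker intermediates, read downwards from the summit -/

/-- W1 (in tree: stmt-NavierStokesRegularity-0155, shared by routes Blowup / DssFarFieldSlaving; OPEN):
CERTIFIED `crux → W1` from the landed dominance theorem. W1 is itself summit-closing (0155 ⇒ X5a ⇒ ¬A,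
both landed), hence not "short of the summit" either. -/
example : QuantisedSymmetry.PolyhedralDssProfileExists → Blowup.BlowupTypeIDssProfile :=
  Theorems.PolyhedralDssProfileExists.PolyhedralCell.stub_dominatesBlowupProfile

/-- W3: the negated kill switch. CERTIFIED `crux → W3` (landed `LiouvilleKillsProfile`). W3 is strictly
weaker in content (any nontrivial bounded ancient mild `G`-equivariant Type-I field, no self-similarity)
and is NOT known to be summit-closing (no truncation bridge without DSS). -/
def NotPolyhedralTypeILiouville : Prop := ¬ QuantisedSymmetry.PolyhedralTypeILiouville

example : QuantisedSymmetry.PolyhedralDssProfileExists → NotPolyhedralTypeILiouville :=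
  fun hX h3 => Theorems.quantisedSymmetry_liouvilleKillsProfile_proof h3 hX

/-- W2: a LOCAL polyhedral Type-I singular point — a suitable weak solution on a region containing the
unit backward parabolic cylinder, `G`-equivariant, obeying the Type-I space–time envelope
`‖u(t,x)‖ ≤ C₀/(‖x‖+√(−t))` there, and essentially unbounded in every backward cylinder at `(0,0)`.
Weaker than the crux in content (no self-similarity, no ancient object); by KNSS-type rescaling it yields
W3, and it is NOT known to imply `¬A` (census §Weaker intermediate). -/
def LocalPolyhedralTypeISingularity : Prop :=
  ∃ G : Subgroup (E3 ≃ₗᵢ[ℝ] E3), IsPolyhedralGroup G ∧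
    ∃ (Q : TopologicalSpace.Opens (ℝ × E3)) (u : ℝ → E3 → E3) (p : ℝ → E3 → ℝ),
      Set.Ioo (-1 : ℝ) 0 ×ˢ Metric.ball (0 : E3) 1 ⊆ (Q : Set (ℝ × E3)) ∧
      IsSuitableWeakSolutionOn Q 1 0 u p ∧
      (∀ g ∈ G, ∀ t x, u t (g x) = g (u t x)) ∧
      (∃ C₀ : ℝ, ∀ t ∈ Set.Ioo (-1 : ℝ) 0, ∀ x ∈ Metric.ball (0 : E3) 1,
        ‖u t x‖ ≤ C₀ / (‖x‖ + Real.sqrt (-t))) ∧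
      ∀ r : ℝ, 0 < r → r ≤ 1 →
        eLpNorm (Function.uncurry u) ⊤
          (volume.restrict (Set.Ioo (-r ^ 2) 0 ×ˢ Metric.ball (0 : E3) r)) = ⊤

/-! ## §2 Decomposition attempt: Newton–Kantorovich split of the polyhedral cell -/

/-- D1(ε): an `ε`-approximate polyhedral cell — a genuine bounded, weakly solenoidal, Oseen-mild,
slice-wise `G`-equivariant field on the model period `[-1, -c⁻²] × ℝ³` whose ZOOM-CLOSING DEFECT
`v(-c⁻², x) − c v(-1, cx)` is at most `ε` pointwise, normalised away from zero in `L⁴`. (`ε = 0` and the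
`L⁴` datum give back `PolyhedralCellExists`, the registered ∃-stub ↔ crux.) The companion piece D2 (inverse
stability of the linearised period map at `v`) is not typeable over existing declarations: the tree has no
period map `Φ_NS(1 − c⁻²)` as a differentiable self-map of a Banach space of fields (census §Decomposition). -/
def ApproxPolyhedralCell (ε : ℝ) : Prop :=
  ∃ G : Subgroup (E3 ≃ₗᵢ[ℝ] E3), IsPolyhedralGroup G ∧
    ∃ c : ℝ, 1 < c ∧ ∃ v : ℝ → E3 → E3,
      ContinuousOn (Function.uncurry v) (Set.Icc (-1 : ℝ) (-(c ^ 2)⁻¹) ×ˢ Set.univ) ∧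
      (∃ M : ℝ, ∀ t ∈ Set.Icc (-1 : ℝ) (-(c ^ 2)⁻¹), ∀ x, ‖v t x‖ ≤ M) ∧
      (∀ t ∈ Set.Icc (-1 : ℝ) (-(c ^ 2)⁻¹), IsWeaklyDivFree (v t)) ∧
      (∀ s t : ℝ, -1 ≤ s → s < t → t ≤ -(c ^ 2)⁻¹ → ∀ x,
        v t x = heatFlow (v s) (t - s) x - oseenDuhamel 1 s v v t x) ∧
      (∀ g ∈ G, ∀ t ∈ Set.Icc (-1 : ℝ) (-(c ^ 2)⁻¹), ∀ x, v t (g x) = g (v t x)) ∧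
      (∀ x, ‖v (-(c ^ 2)⁻¹) x - c • v (-1) (c • x)‖ ≤ ε) ∧
      MemLp (v (-1)) 4 volume ∧ 1 ≤ (eLpNorm (v (-1)) 4 volume).toReal

/-! ## §4 Strengthening attempt: a Beltrami (force-free) profile -/

/-- S⁺_Beltrami: the crux with a slice-wise Beltrami profile (`curl u(t) = f u(t)`). EMPTY CLASS (census
§Strengthen): Beltrami makes `(u·∇)u = ∇(|u|²/2)`, so each component is an ancient caloric function with
the Type-I envelope, hence `0` by the heat maximum principle as `t → −∞`; the added rigidity linearises the
problem away. -/
def BeltramiPolyhedralDssProfileExists : Prop :=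
  ∃ G : Subgroup (E3 ≃ₗᵢ[ℝ] E3), IsPolyhedralGroup G ∧ ∃ c : ℝ, 1 < c ∧ ∃ u : ℝ → E3 → E3,
    IsAncientMildSolution 1 u ∧ (∀ t < 0, AEStronglyMeasurable (u t) volume) ∧
    IsDiscretelySelfSimilar c u ∧ (∃ C₀ : ℝ, HasTypeIDecay C₀ u) ∧
    (∀ g ∈ G, ∀ t x, u t (g x) = g (u t x)) ∧ ¬ (∀ t < 0, u t =ᵐ[volume] 0) ∧
    ∀ t < 0, ∃ f : E3 → ℝ, ∀ x, curl (u t) x = f x • u t x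

/-- CERTIFIED (trivial direction): S⁺_Beltrami ⇒ crux. -/
example : BeltramiPolyhedralDssProfileExists → QuantisedSymmetry.PolyhedralDssProfileExists := by
  rintro ⟨G, ⟨hfin, hdet, hirr⟩, c, hc, u, h1, h2, h3, h4, h5, h6, -⟩
  exact ⟨G, hfin, hdet, hirr, c, hc, u, h1, h2, h3, h4, h5, h6⟩

end Summit.NavierStokesRegularity.NavierStokesRegularity.Cruxes.PolyhedralDssProfileExists.StrategistS15

end
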